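import Literature.Topology.FourManifolds.DavisHyperbolicFourManifold
import Literature.Geometry.Riemannian.QuotientMetric
import Literature.Geometry.Riemannian.ConstantCurvatureDescent
import Literature.Geometry.Riemannian.HyperboloidModel
import HarnessLib

/-!
# A cocompact free properly discontinuous group of isometries of `ℍ⁴` gives a closed hyperbolic 4-manifold

Topic `Literature/Topology/FourManifolds`. Support file (everything PROVED, no named fact) for the
named fact `Literature.Topology.FourManifolds.Davis1985_exists_closed_hyperbolic_four`
(`DavisHyperbolicFourManifold.lean`): the ASSEMBLY step of Davis' argument (Davis 1985, §3,
p. 327: "`K` is torsion-free. Consequently, `K` acts freely on `H⁴`, and `M⁴` is a hyperbolic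
4-manifold"; `K` of finite index in a discrete cocompact group, so `M⁴ = H⁴/K` is closed) — i.e.
Lee, *Introduction to Riemannian Manifolds* (2018), Prop. 2.32 / Cor. 2.33 (a free, proper,
isometric action of a discrete group on `(M̃, g̃)` gives a Riemannian manifold `M̃/Γ` locally
isometric to `M̃`) specialised to the statement of the fact — assembled from the tree:

* `Literature/Geometry/Manifold/QuotientManifold.lean` (`isManifold`, `contMDiff_mk`: the orbit
  space of a free properly discontinuous `C^∞` action is a `C^∞` manifold, Mathlib's charted space
  `MulAction.instChartedSpaceQuotient`);
* `Literature/Geometry/Riemannian/QuotientMetric.lean` (`quotientMetric`, `comap_mk_quotientMetric`,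
  `isRiemannian_quotientMetric`: the quotient metric, `mk^* ḡ = g`);
* `Literature/Geometry/Riemannian/ConstantCurvatureDescent.lean`
  (`hasConstantSectionalCurvature_of_comap_of_surjective`: constant curvature descends);
* `Literature/Geometry/Riemannian/HyperboloidModel.lean` (`Hyperboloid.metric ⊤`,
  `Hyperboloid.hasConstantSectionalCurvature`: `ℍ⁴` in the graph chart has curvature `-1`).

Results:

* `exists_closed_hyperbolic_four_of_cocompact_action` — for ANY connected `C^∞` 4-manifold `M`
  (modelled on `EuclideanSpace ℝ (Fin 4)`) with a `C^∞` Riemannian metric of constant sectional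
  curvature `-1` and a group `Γ` acting freely, properly discontinuously, by `C^∞` isometries,
  with a compact set meeting every orbit, the fact `Davis1985_exists_closed_hyperbolic_four` holds
  (witness: `M/Γ` with the quotient metric);
* `exists_closed_hyperbolic_four_of_cocompact_action_hyperboloid` — the same for
  `M = ℍ⁴ = (⊤ : Opens (EuclideanSpace ℝ (Fin 4)))` with `Hyperboloid.metric ⊤`.

What remains for the fact itself (other files): a subgroup of `O⁺(4,1)` acting this way on `ℍ⁴`
(Davis 1985: a torsion-free finite-index subgroup of the cocompact `[5,3,3,5]` reflection group).

## References

* M. W. Davis, *A hyperbolic 4-manifold*, Proc. Amer. Math. Soc. 93 (1985) 325–328, §3.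
  [`Davis1985`]
* J. M. Lee, *Introduction to Riemannian Manifolds*, 2nd ed. (2018), Prop. 2.32, Cor. 2.33.
  [`Lee2018`]
-/

noncomputable section

open scoped Manifold ContDiff Topology
open Set Function MulAction TopologicalSpace

namespace Literature.Topology.FourManifolds

open Literature.Geometry.Lorentzian Literature.Geometry.Lorentzian.PseudoRiemannianMetric
  Literature.Geometry.Riemannian Literature.Geometry.Manifold

/-- Local notation: the model space `ℝ⁴`. -/
local notation "𝔼4" => EuclideanSpace ℝ (Fin 4)

section General

variable {M : Type} [TopologicalSpace M] [T2Space M] [LocallyCompactSpace M]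
  [SecondCountableTopology M] [ConnectedSpace M] [ChartedSpace 𝔼4 M] [IsManifold (𝓡 4) ∞ M]
  {Γ : Type*} [Group Γ] [MulAction Γ M] [ProperlyDiscontinuousSMul Γ M] [ContinuousConstSMul Γ M]
  [IsCancelSMul Γ M]

/-- **A cocompact free properly discontinuous group of `C^∞` isometries of a connected manifold of
constant curvature `-1` yields a closed hyperbolic 4-manifold** (the assembly step of Davis 1985,
§3; Lee 2018, Prop. 2.32 / Cor. 2.33): if `Γ` acts freely (`IsCancelSMul`), properly
discontinuously and by `C^∞` isometries (`hsmooth`, `hinv`) on a connected `C^∞` 4-manifold `M`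
carrying a `C^∞` Riemannian metric `g` of constant sectional curvature `-1`, and some compact
`K ⊆ M` meets every orbit, then `M/Γ` (Mathlib's orbit space with its quotient charted space,
a `C^∞` manifold by `QuotientManifold.isManifold`) with the quotient metric
(`QuotientMetric.quotientMetric`) is a compact connected Hausdorff second countable `C^∞`
4-manifold with a Riemannian metric of constant sectional curvature `-1`
(`hasConstantSectionalCurvature_of_comap_of_surjective` along `mk`, `comap_mk_quotientMetric`);
in particular `Davis1985_exists_closed_hyperbolic_four` holds. [cite: Davis1985, §3 (p. 327)] -/
theorem exists_closed_hyperbolic_four_of_cocompact_action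
    (g : PseudoRiemannianMetric (𝓡 4) ∞ 𝔼4 (TangentSpace (𝓡 4) : M → Type _))
    (hg : g.IsRiemannian) (hc : g.HasConstantSectionalCurvature (-1))
    (hsmooth : ∀ γ : Γ, ContMDiff (𝓡 4) (𝓡 4) ∞ (fun x : M ↦ γ • x))
    (hinv : ∀ (γ : Γ) (y : M) (v w : TangentSpace (𝓡 4) y),
      g.val (γ • y) (mfderiv (𝓡 4) (𝓡 4) (fun x : M ↦ γ • x) y v)
        (mfderiv (𝓡 4) (𝓡 4) (fun x : M ↦ γ • x) y w) = g.val y v w)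
    (hcpt : ∃ K : Set M, IsCompact K ∧ ∀ x : M, ∃ γ : Γ, γ • x ∈ K) :
    Davis1985_exists_closed_hyperbolic_four := by
  haveI hman : IsManifold (𝓡 4) ∞ (orbitRel.Quotient Γ M) := QuotientManifold.isManifold hsmooth
  haveI : SecondCountableTopology (orbitRel.Quotient Γ M) :=
    ContinuousConstSMul.secondCountableTopology
  haveI : CompactSpace (orbitRel.Quotient Γ M) := by
    obtain ⟨K, hK, hKorb⟩ := hcpt
    refine ⟨?_⟩
    have himg : (QuotientManifold.mk (G := Γ) (M := M)) '' K = univ := by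
      refine eq_univ_of_forall fun q ↦ ?_
      obtain ⟨x, rfl⟩ := Quotient.mk_surjective (s := orbitRel Γ M) q
      obtain ⟨γ, hγ⟩ := hKorb x
      exact ⟨γ • x, hγ, QuotientManifold.mk_smul γ x⟩
    rw [← himg]
    exact hK.image continuous_quotient_mk'
  set gbar := QuotientMetric.quotientMetric g hsmooth hinv with hgbar
  have hriem : gbar.IsRiemannian := QuotientMetric.isRiemannian_quotientMetric g hsmooth hinv hg
  have hcurv : gbar.HasConstantSectionalCurvature (-1) := by
    refine hasConstantSectionalCurvature_of_comap_of_surjective gbar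
      contMDiff_pullbackBilin_holds (QuotientMetric.contMDiff_mk_infty_add_one hsmooth)
      (QuotientMetric.injective_mfderiv_mk hsmooth) rfl
      (Quotient.mk_surjective (s := orbitRel Γ M)) ?_
    rw [hgbar, QuotientMetric.comap_mk_quotientMetric g hsmooth hinv]
    exact hc
  exact ⟨orbitRel.Quotient Γ M, inferInstance, inferInstance, inferInstance, inferInstance, hman,
    inferInstance, inferInstance, gbar, hriem, hcurv⟩

end General

/-- **Specialisation to hyperbolic space `ℍ⁴`** in the graph chart of the hyperboloid model
(`Hyperboloid.metric ⊤` on `⊤ : Opens (EuclideanSpace ℝ (Fin 4))`, constant curvature `-1` by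
`Hyperboloid.hasConstantSectionalCurvature`, Riemannian by `Hyperboloid.isRiemannian_metric`):
a group acting freely, properly discontinuously, cocompactly and by `C^∞` isometries of the
hyperbolic metric gives `Davis1985_exists_closed_hyperbolic_four` (Davis 1985, §3: `M⁴ = H⁴/K`).
[cite: Davis1985, §3 (p. 327)] -/
theorem exists_closed_hyperbolic_four_of_cocompact_action_hyperboloid
    {Γ : Type*} [Group Γ] [MulAction Γ (⊤ : Opens 𝔼4)]
    [ProperlyDiscontinuousSMul Γ (⊤ : Opens 𝔼4)] [ContinuousConstSMul Γ (⊤ : Opens 𝔼4)]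
    [IsCancelSMul Γ (⊤ : Opens 𝔼4)]
    (hsmooth : ∀ γ : Γ, ContMDiff (𝓡 4) (𝓡 4) ∞ (fun x : (⊤ : Opens 𝔼4) ↦ γ • x))
    (hinv : ∀ (γ : Γ) (y : (⊤ : Opens 𝔼4)) (v w : TangentSpace (𝓡 4) y),
      (Hyperboloid.metric ⊤).val (γ • y) (mfderiv (𝓡 4) (𝓡 4) (fun x : (⊤ : Opens 𝔼4) ↦ γ • x) y v)
        (mfderiv (𝓡 4) (𝓡 4) (fun x : (⊤ : Opens 𝔼4) ↦ γ • x) y w) =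
        (Hyperboloid.metric ⊤).val y v w)
    (hcpt : ∃ K : Set (⊤ : Opens 𝔼4), IsCompact K ∧ ∀ x, ∃ γ : Γ, γ • x ∈ K) :
    Davis1985_exists_closed_hyperbolic_four := by
  haveI : ConnectedSpace (⊤ : Opens 𝔼4) :=
    isConnected_iff_connectedSpace.1 (by simpa using isConnected_univ (α := 𝔼4))
  haveI : LocallyCompactSpace (⊤ : Opens 𝔼4) := isOpen_univ.locallyCompactSpace
  exact exists_closed_hyperbolic_four_of_cocompact_action (Hyperboloid.metric ⊤)
    Hyperboloid.isRiemannian_metric Hyperboloid.hasConstantSectionalCurvature hsmooth hinv hcpt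

end Literature.Topology.FourManifolds
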